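import Summits.FinalStateConjecture.FinalStateConjecture.Theorems.PhaseMixingCaptureCaptureSufficesTameNoC0KerrSide
import Summits.FinalStateConjecture.FinalStateConjecture.Theorems.PhaseMixingCaptureCaptureSufficesTameNoC0KerrLocal
import Literature.Geometry.Lorentzian.KerrSliceFacts
import Literature.Geometry.Lorentzian.OpensCausality
import Literature.Geometry.Lorentzian.CausalCurveNullGeodesic
import Literature.Geometry.Lorentzian.LocalCausalRelationClosed
import Literature.Geometry.Lorentzian.LocalTimeSeparation
import Literature.Geometry.Lorentzian.LorentzianDistance
import Literature.Geometry.Lorentzian.KerrFramedCompactness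
import Literature.Geometry.Lorentzian.NormalisedNullRayCausal
import Literature.Geometry.Lorentzian.GeodesicMaximalFlow
import HarnessLib

/-!
# NoC0KerrChart limit argument I: shared lemmas

Crux `CaptureSufficesTame` (stmt-FinalStateConjecture-17270), line `only-the-third-law-is-generic`, G's model point
(NoC0KerrChart programme: no `C⁰`-honest late chart of a boosted Kerr exterior into Minkowski space), lead c10.
Registered sub-goal of this file: `stub_noC0_orbitKinematics` (`NoC0.orbit_norm_sub_le`).

Contents (namespace `NoC0`): kinematics of the retrograde photon orbit `Kerr.orbitCurve` (`t*` has speed bound 2 along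
causal curves of the Kerr exterior); the orbit moves (`orbit_apply_one_ne`); tube bookkeeping (`mem_orbitTube`,
`cthickening_subset_of_near_orbit`); lifts of coordinate curves known to be in the exterior only along an interval
(`isFutureCausalCurveOn_diteLift`); the radial timelike geodesic as a `C¹` coordinate curve (`radial_coordCurve`);
the TRANSPLANT CONTRADICTION (`transplant_contra`: a `g`-timelike `C¹` coordinate curve whose endpoints are approximated
by `b_n ∈ C_n`, `w_n ∉ O_n` is impossible once the cone fields `B_n → g`, by (TL) and the defining property of `O_n`);
and LIMITS OF `B_n`-CAUSAL CURVES GIVE CAUSAL RELATIONS (`limit_mem_causalFuture`: drift by `50 ε_n (t − α) ∂_{t*}`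
(DL3, stationarity), lift, `exists_nhds_causalRelation_closed`).

References: B. O'Neill, *Semi-Riemannian geometry* (1983), Ch. 5, Ch. 14 (keys `ONeill1983`, `ONeillSemiRiemannian1983`);
J. Sbierski, *The C⁰-inextendibility of the Schwarzschild spacetime…*, J. Diff. Geom. 108 (2018) / arXiv:1507.00601, §3
(key `Sbierski2016AHP`); J. Sbierski, Anal. PDE 8 (2015), §7A (key `Sbierski2015`); M. Visser, arXiv:0706.0622 (key `arXiv07060622`).
-/

set_option linter.dupNamespace false
set_option maxSynthPendingDepth 3

noncomputable section

open Set Filter Function Bundle MeasureTheory Metric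
open scoped Manifold ContDiff Topology ENNReal

namespace Summit.FinalStateConjecture.FinalStateConjecture.Theorems.PhaseMixingCaptureCaptureSufficesTame

open Literature.Geometry.Lorentzian Literature.Geometry.Riemannian

namespace NoC0

variable {M a : ℝ}

/-- **Kinematics of the photon orbit**: `‖c(s₂) − c(s₁)‖ ≤ 2 (e s₂ − e s₁)` for `s₁ ≤ s₂` (`t* = e s` along the orbit and
`t*` is a time function with speed bound `2`, `kerr_time_strictMonoOn_and_norm_sub_le`). [cite: Sbierski2015, §7A] -/
theorem orbit_norm_sub_le (M a r₀ e : ℝ) (hM : 0 < M) (ha0 : 0 ≤ a) (h3 : 3 * M ≤ r₀)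
    (hcubic : r₀ * (r₀ - 3 * M) ^ 2 = 4 * a ^ 2 * M) (he : e = 1 - a * √(M / r₀ ^ 3)) (he0 : 0 < e)
    (s₁ s₂ : ℝ) (hs : s₁ ≤ s₂) :
    ‖Kerr.orbitCurve a r₀ √(M / r₀ ^ 3) s₂ - Kerr.orbitCurve a r₀ √(M / r₀ ^ 3) s₁‖ ≤ 2 * (e * s₂ - e * s₁) := by
  have hr₀ : 0 < r₀ := by linarith
  have hq2 : √(M / r₀ ^ 3) ^ 2 * r₀ ^ 3 = M := by
    rw [Real.sq_sqrt (by positivity)]; field_simp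
  have htime : ∀ s, Kerr.orbitCurve a r₀ √(M / r₀ ^ 3) s 0 = e * s := fun s ↦ by
    rw [Kerr.orbitCurve_apply_zero, he]
  have h := (kerr_time_strictMonoOn_and_norm_sub_le M a
    (fun s ↦ Kerr.bilin M a (Kerr.orbitCurve a r₀ √(M / r₀ ^ 3) s)) (Kerr.orbitCurve a r₀ √(M / r₀ ^ 3)) s₁ s₂
    hM.le hs (fun t _ ↦ ⟨by simp, _, Kerr.hasDerivAt_orbitCurve t,
      (Kerr.bilin_orbitVel_self hM ha0 h3 (Real.sqrt_nonneg _) hq2 hcubic t).le,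
      by rw [Kerr.orbitVel_apply_zero, ← he]; exact he0⟩)).2
  rwa [htime, htime] at h

/-- `t*`-parametrised form of `orbit_norm_sub_le`: `‖Γ t₂ − Γ t₁‖ ≤ 2 (t₂ − t₁)`, `Γ t = c(t/e)`. [cite: Sbierski2015, §7A] -/
theorem orbit_norm_sub_le' (M a r₀ e : ℝ) (hM : 0 < M) (ha0 : 0 ≤ a) (h3 : 3 * M ≤ r₀)
    (hcubic : r₀ * (r₀ - 3 * M) ^ 2 = 4 * a ^ 2 * M) (he : e = 1 - a * √(M / r₀ ^ 3)) (he0 : 0 < e)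
    (t₁ t₂ : ℝ) (ht : t₁ ≤ t₂) :
    ‖Kerr.orbitCurve a r₀ √(M / r₀ ^ 3) (t₂ / e) - Kerr.orbitCurve a r₀ √(M / r₀ ^ 3) (t₁ / e)‖ ≤ 2 * (t₂ - t₁) := by
  have h := orbit_norm_sub_le M a r₀ e hM ha0 h3 hcubic he he0 (t₁ / e) (t₂ / e)
    (by rw [div_le_div_iff_of_pos_right he0]; exact ht)
  have h1 : e * (t₂ / e) = t₂ := by field_simp
  have h2 : e * (t₁ / e) = t₁ := by field_simp
  rwa [h1, h2] at h

/-- **The orbit moves**: for `0 < s` with `2s ≤ eS` (less than half a period) the `x`-coordinate of `Γ s` differs from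
that of `p₀ = Γ 0` (`cos θ = 1` only at `θ ∈ 2πℤ`). [folklore] -/
theorem orbit_apply_one_ne (M a r₀ e S : ℝ) (hM : 0 < M) (h3 : 3 * M ≤ r₀) (hS : S = 2 * Real.pi / √(M / r₀ ^ 3))
    (he0 : 0 < e) (s : ℝ) (hs : 0 < s) (hsS : 2 * s ≤ e * S) :
    Kerr.orbitCurve a r₀ √(M / r₀ ^ 3) (s / e) 1 ≠ Kerr.orbitCurve a r₀ √(M / r₀ ^ 3) 0 1 := by
  intro h1
  have hr₀ : 0 < r₀ := by linarith
  simp only [Kerr.orbitCurve_apply_one, mul_zero, Real.cos_zero, mul_one] at h1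
  have hA0 : 0 < √(r₀ ^ 2 + a ^ 2) := Real.sqrt_pos.2 (by positivity)
  have hcos : Real.cos (√(M / r₀ ^ 3) * (s / e)) = 1 := mul_left_cancel₀ hA0.ne' (h1.trans (mul_one _).symm)
  have harg : 0 < √(M / r₀ ^ 3) * (s / e) := by positivity
  have harg2 : √(M / r₀ ^ 3) * (s / e) < 2 * Real.pi := by
    have hse : s / e ≤ S / 2 := by rw [div_le_iff₀ he0]; linarith
    calc √(M / r₀ ^ 3) * (s / e) ≤ √(M / r₀ ^ 3) * (S / 2) := by gcongr
      _ = Real.pi := by rw [hS]; field_simp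
      _ < 2 * Real.pi := by linarith [Real.pi_pos]
  rw [Real.cos_eq_one_iff_of_lt_of_lt (by linarith [Real.pi_pos]) harg2] at hcos
  linarith

/-- Points within `δ` of a `t*`-small orbit point are in the `δ`-tube of one and a half revolutions. [folklore] -/
theorem mem_orbitTube {a r₀ q e S δ : ℝ} (he0 : 0 < e) (hS0 : 0 ≤ S) (t : ℝ) (z : E4) (ht0 : 0 ≤ t)
    (htS : t ≤ 2 * (e * S)) (hz : ‖z - Kerr.orbitCurve a r₀ q (t / e)‖ ≤ δ) :
    z ∈ cthickening δ (Kerr.orbitCurve a r₀ q '' Icc (-S) (2 * S)) := by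
  refine Metric.mem_cthickening_of_dist_le z _ δ _ ⟨t / e, ⟨?_, ?_⟩, rfl⟩ (by rwa [dist_eq_norm])
  · have : 0 ≤ t / e := div_nonneg ht0 he0.le
    linarith
  · rw [div_le_iff₀ he0]; linarith

/-- The `η₀/2`-tube of a set all of whose points are `η₀/2`-close to `t*`-small orbit points lies in `Ω ⊇` the `η₀`-tube of
the orbit. [folklore] -/
theorem cthickening_subset_of_near_orbit {a r₀ q e S η₀ : ℝ} {Ω : Set E4} (he0 : 0 < e) (hS0 : 0 ≤ S) (hη₀ : 0 < η₀)
    (htube : cthickening η₀ (Kerr.orbitCurve a r₀ q '' Icc (-S) (2 * S)) ⊆ Ω) (A : Set E4)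
    (hA : ∀ z ∈ A, ∃ t, 0 ≤ t ∧ t ≤ 2 * (e * S) ∧ ‖z - Kerr.orbitCurve a r₀ q (t / e)‖ ≤ η₀ / 2) :
    cthickening (η₀ / 2) A ⊆ Ω := by
  have hA' : A ⊆ cthickening (η₀ / 2) (Kerr.orbitCurve a r₀ q '' Icc (-S) (2 * S)) := by
    intro w hw
    obtain ⟨t, ht0, htS, hwt⟩ := hA w hw
    exact mem_orbitTube he0 hS0 t w ht0 htS hwt
  refine (Metric.cthickening_subset_of_subset _ hA').trans
    (((Metric.cthickening_cthickening_subset (half_pos hη₀).le (half_pos hη₀).le _)).trans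
      ((Metric.cthickening_mono (by linarith) _).trans htube))

open Classical in
/-- **Lift of a coordinate curve known to be in the exterior only along the parameter interval**: the
`dite`-lift `t ↦ ⟨c t, _⟩` (junk value `p` elsewhere) is a future causal curve of the Kerr exterior on `s`
as soon as, at every `t ∈ s`, `c t` lies in the exterior and `c` has a `g`-causal future derivative.
[cite: arXiv08110354, §5.1] -/
theorem isFutureCausalCurveOn_diteLift [Kerr.Facts] (hM : 0 ≤ M) (p : Kerr.exterior M a) {c : ℝ → E4}
    {s : Set ℝ} {v : ℝ → E4} (hmem : ∀ t ∈ s, c t ∈ Kerr.exterior M a)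
    (hd : ∀ t ∈ s, HasDerivAt c (v t) t) (hcausal : ∀ t ∈ s, Kerr.bilin M a (c t) (v t) (v t) ≤ 0)
    (hfut : ∀ t ∈ s, 0 < v t 0) :
    (Kerr.smoothMetric M a (Kerr.rPlus M a)).IsFutureCausalCurveOn
      (Kerr.exteriorSpacetime M a hM).timeOrientation
      (fun t ↦ if h : c t ∈ Kerr.exterior M a then (⟨c t, h⟩ : Kerr.exterior M a) else p) s ∧
    ∀ t ∈ s, (velocity 𝓘(ℝ, E4)
      (fun t ↦ if h : c t ∈ Kerr.exterior M a then (⟨c t, h⟩ : Kerr.exterior M a) else p) t : E4) = v t := by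
  set γ : ℝ → Kerr.exterior M a :=
    fun t ↦ if h : c t ∈ Kerr.exterior M a then (⟨c t, h⟩ : Kerr.exterior M a) else p with hγ
  -- near every parameter of `s`, the lift read in coordinates IS `c`
  have hev : ∀ t ∈ s, (Subtype.val ∘ γ) =ᶠ[𝓝 t] c := by
    intro t ht
    have hnear : ∀ᶠ u in 𝓝 t, c u ∈ Kerr.exterior M a :=
      (hd t ht).continuousAt.preimage_mem_nhds ((Kerr.exterior M a).isOpen.mem_nhds (hmem t ht))
    filter_upwards [hnear] with u hu
    simp only [comp_apply, hγ, dif_pos hu]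
  have hmd : ∀ t ∈ s, MDifferentiableAt 𝓘(ℝ, ℝ) 𝓘(ℝ, E4) γ t := by
    intro t ht
    rw [← mdifferentiableAt_subtypeVal_comp_curve_iff (I := 𝓘(ℝ, E4)) (Kerr.exterior M a)]
    exact ((hev t ht).mdifferentiableAt_iff).2 (hd t ht).differentiableAt.mdifferentiableAt
  have hvel : ∀ t ∈ s, (velocity 𝓘(ℝ, E4) γ t : E4) = v t := by
    intro t ht
    rw [← velocity_subtypeVal_comp (I := 𝓘(ℝ, E4)) (Kerr.exterior M a) γ t,
      velocity_congr_of_eventuallyEq (I := 𝓘(ℝ, E4)) (hev t ht)]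
    change mfderiv 𝓘(ℝ, ℝ) 𝓘(ℝ, E4) c t (1 : ℝ) = v t
    rw [mfderiv_eq_fderiv, (hd t ht).hasFDerivAt.fderiv]
    exact ContinuousLinearMap.toSpanSingleton_apply_one ℝ (v t)
  have hγt : ∀ t (ht : t ∈ s), γ t = ⟨c t, hmem t ht⟩ := fun t ht ↦ by simp only [hγ, dif_pos (hmem t ht)]
  refine ⟨fun t ht ↦ ⟨hmd t ht, ?_, ?_⟩, hvel⟩
  · refine ⟨?_, ?_⟩
    · show Kerr.bilin M a (γ t : E4) (velocity 𝓘(ℝ, E4) γ t) (velocity 𝓘(ℝ, E4) γ t) ≤ 0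
      rw [hvel t ht, hγt t ht]; exact hcausal t ht
    · intro h0
      have h1 : (v t) 0 = 0 := by
        have := congrArg (fun w : E4 ↦ w 0) ((hvel t ht).symm.trans (congrArg (fun w ↦ (w : E4)) h0))
        exact this
      linarith [hfut t ht, h1]
  · show Kerr.bilin M a (γ t : E4) (Kerr.timeVector M a (γ t : E4)) (velocity 𝓘(ℝ, E4) γ t) < 0
    have hr : 0 < Kerr.radius a (c t) := Kerr.radius_pos_of_mem_region (hmem t ht)
    rw [hvel t ht, hγt t ht]
    change Kerr.bilin M a (c t) (Kerr.timeVector M a (c t)) (v t) < 0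
    rw [Kerr.bilin_timeVector hr]
    linarith [hfut t ht]

open Classical in
/-- Timelike version of `isFutureCausalCurveOn_diteLift`. [cite: arXiv08110354, §5.1] -/
theorem isFutureTimelikeCurveOn_diteLift [Kerr.Facts] (hM : 0 ≤ M) (p : Kerr.exterior M a) {c : ℝ → E4}
    {s : Set ℝ} {v : ℝ → E4} (hmem : ∀ t ∈ s, c t ∈ Kerr.exterior M a)
    (hd : ∀ t ∈ s, HasDerivAt c (v t) t) (htl : ∀ t ∈ s, Kerr.bilin M a (c t) (v t) (v t) < 0)
    (hfut : ∀ t ∈ s, 0 < v t 0) :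
    (Kerr.smoothMetric M a (Kerr.rPlus M a)).IsFutureTimelikeCurveOn
      (Kerr.exteriorSpacetime M a hM).timeOrientation
      (fun t ↦ if h : c t ∈ Kerr.exterior M a then (⟨c t, h⟩ : Kerr.exterior M a) else p) s := by
  obtain ⟨hc, hvel⟩ := isFutureCausalCurveOn_diteLift hM p hmem hd (fun t ht ↦ (htl t ht).le) hfut
  intro t ht
  obtain ⟨hmd, hcs, hf⟩ := hc t ht
  refine ⟨hmd, ?_, hcs, hf⟩
  have hγt : (fun t ↦ if h : c t ∈ Kerr.exterior M a then (⟨c t, h⟩ : Kerr.exterior M a) else p) t =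
      ⟨c t, hmem t ht⟩ := by simp only [dif_pos (hmem t ht)]
  show Kerr.bilin M a ((fun t ↦ if h : c t ∈ Kerr.exterior M a then (⟨c t, h⟩ : Kerr.exterior M a) else p) t : E4)
    (velocity 𝓘(ℝ, E4) (fun t ↦ if h : c t ∈ Kerr.exterior M a then (⟨c t, h⟩ : Kerr.exterior M a) else p) t)
    (velocity 𝓘(ℝ, E4) (fun t ↦ if h : c t ∈ Kerr.exterior M a then (⟨c t, h⟩ : Kerr.exterior M a) else p) t) < 0
  rw [hvel t ht, hγt]
  exact htl t ht

/-- **The radial geodesic as a `C¹` coordinate curve**: for `v ∈ 𝓔_y` future timelike, the curve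
`r ↦ exp_y(r v)` read in Kerr–Schild coordinates has, on `[0, 1]`, a continuous derivative which is
`g`-timelike and future (`∂₀`-component positive), starts at `y` and ends at `exp_y v`.
[cite: ONeillSemiRiemannian1983, Ch. 5, Prop. 5.34] -/
theorem radial_coordCurve [Kerr.Facts] [Kerr.SliceFacts] (hM : 0 ≤ M) (y : Kerr.exterior M a)
    (v : E4) (hv : (v : TangentSpace 𝓘(ℝ, E4) y) ∈ expDomain (Kerr.smoothMetric M a (Kerr.rPlus M a)).leviCivita y)
    (hvt : (Kerr.smoothMetric M a (Kerr.rPlus M a)).IsTimelike (x := y) v)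
    (hvf : (Kerr.exteriorSpacetime M a hM).timeOrientation.IsFutureDirected (x := y) v) :
    ∃ (β β' : ℝ → E4), ContinuousOn β' (Icc 0 1) ∧ β 0 = y ∧
      β 1 = ((expMap (Kerr.smoothMetric M a (Kerr.rPlus M a)).leviCivita y
        (show TangentSpace 𝓘(ℝ, E4) y from v) : Kerr.region a (Kerr.rPlus M a)) : E4) ∧
      ∀ r ∈ Icc 0 1, β r ∈ (Kerr.exterior M a : Set E4) ∧ HasDerivAt β (β' r) r ∧
        Kerr.bilin M a (β r) (β' r) (β' r) < 0 ∧ 0 < β' r 0 := by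
  haveI : Fact ((1 : ℕ∞ω) ≤ (∞ : ℕ∞ω)) := ⟨by exact_mod_cast le_top⟩
  haveI := LorentzianMetric.contMDiffCovariantDerivative_leviCivita_one (Kerr.smoothMetric M a (Kerr.rPlus M a))
  set cov := (Kerr.smoothMetric M a (Kerr.rPlus M a)).leviCivita with hcov
  set γ : ℝ → Kerr.region a (Kerr.rPlus M a) :=
    fun r ↦ expMap cov y ((r • v : E4) : TangentSpace 𝓘(ℝ, E4) y) with hγ
  set β : ℝ → E4 := fun r ↦ (γ r : E4) with hβ
  -- the open parameter domain and the star-shapedness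
  obtain ⟨hmax, h0, -, -⟩ := maximalGeodesic_spec' (cov := cov) y (show TangentSpace 𝓘(ℝ, E4) y from v)
  set D := maximalGeodesicDomain cov y (show TangentSpace 𝓘(ℝ, E4) y from v) with hD
  have hDo : IsOpen D := hmax.isOpen
  have hIccD : Icc (0 : ℝ) 1 ⊆ D := hmax.2.1.out h0 hv.2
  -- smoothness of `β` on `D` as a map between vector spaces
  have hf : ContMDiffOn 𝓘(ℝ, E4) 𝓘(ℝ, E4) 1 (fun w : E4 ↦ ((expMap cov y (show TangentSpace 𝓘(ℝ, E4) y from w) :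
      Kerr.region a (Kerr.rPlus M a)) : E4)) {w : E4 | (show TangentSpace 𝓘(ℝ, E4) y from w) ∈ expDomain cov y} :=
    (contMDiff_subtype_val.of_le le_top).comp_contMDiffOn (contMDiffOn_expMap (cov := cov) le_rfl y)
  have hline : ContMDiff 𝓘(ℝ, ℝ) 𝓘(ℝ, E4) 1 (fun r : ℝ ↦ (r • v : E4)) :=
    (contDiff_id.smul contDiff_const).contMDiff
  have hβs : ContMDiffOn 𝓘(ℝ, ℝ) 𝓘(ℝ, E4) 1 β D := by
    refine hf.comp hline.contMDiffOn fun r hr ↦ ?_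
    exact (mem_maximalGeodesicDomain_iff_smul_mem_expDomain (cov := cov) y _ r).1 hr
  have hβc : ContDiffOn ℝ 1 β D := contMDiffOn_iff_contDiffOn.1 hβs
  set β' : ℝ → E4 := deriv β with hβ'
  have hβ'c : ContinuousOn β' D := hβc.continuousOn_deriv_of_isOpen hDo le_rfl
  have hβd : ∀ r ∈ D, HasDerivAt β (β' r) r := fun r hr ↦
    ((hβc.differentiableOn one_ne_zero).differentiableAt (hDo.mem_nhds hr)).hasDerivAt
  -- the velocity of the radial geodesic, read in coordinates, is `β'`
  have hvel : ∀ r ∈ D, (velocity 𝓘(ℝ, E4) γ r : E4) = β' r := by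
    intro r hr
    rw [← velocity_subtypeVal_comp (I := 𝓘(ℝ, E4)) (Kerr.region a (Kerr.rPlus M a)) γ r]
    change mfderiv 𝓘(ℝ, ℝ) 𝓘(ℝ, E4) β r (1 : ℝ) = β' r
    rw [mfderiv_eq_fderiv, (hβd r hr).hasFDerivAt.fderiv]
    exact ContinuousLinearMap.toSpanSingleton_apply_one ℝ (β' r)
  refine ⟨β, β', hβ'c.mono hIccD, ?_, ?_, fun r hr ↦ ⟨(γ r).2, hβd r (hIccD hr), ?_, ?_⟩⟩
  · show ((expMap cov y (((0 : ℝ) • v : E4) : TangentSpace 𝓘(ℝ, E4) y) : Kerr.region a (Kerr.rPlus M a)) : E4) = y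
    rw [zero_smul]
    exact congrArg Subtype.val (expMap_zero (cov := cov) y)
  · show ((expMap cov y (((1 : ℝ) • v : E4) : TangentSpace 𝓘(ℝ, E4) y) : Kerr.region a (Kerr.rPlus M a)) : E4) = _
    rw [one_smul]
  · have h := (isTimelike_isFutureDirected_velocity_expMap_smul (g := Kerr.smoothMetric M a (Kerr.rPlus M a))
      (Kerr.exteriorSpacetime M a hM).timeOrientation hvt hvf (hIccD hr)).1
    have h' : Kerr.bilin M a (γ r : E4) (velocity 𝓘(ℝ, E4) γ r) (velocity 𝓘(ℝ, E4) γ r) < 0 := h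
    rwa [hvel r (hIccD hr)] at h'
  · have h := (isTimelike_isFutureDirected_velocity_expMap_smul (g := Kerr.smoothMetric M a (Kerr.rPlus M a))
      (Kerr.exteriorSpacetime M a hM).timeOrientation hvt hvf (hIccD hr)).2.2
    have hrpos : 0 < Kerr.radius a (γ r : E4) := Kerr.radius_pos_of_mem_region (γ r).2
    have h' : Kerr.bilin M a (γ r : E4) (Kerr.timeVector M a (γ r : E4)) (velocity 𝓘(ℝ, E4) γ r) < 0 := h
    rw [hvel r (hIccD hr), Kerr.bilin_timeVector hrpos] at h'
    change -(β' r 0) < 0 at h'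
    linarith

/-- **Transplant contradiction**: a `C¹` coordinate curve on `[0, 1]`, `g_{M,a}`-timelike with future time component,
whose `δ₀`-tube lies in `Ω`, cannot have its endpoints approximated (along a filter) by points `b_n ∈ C_n` and
`w_n ∉ O_n` while the cone fields `B_n` converge to `g` — by (TL) the perturbed curve is `B_n`-timelike from `b_n` to
`w_n`, so `w_n ∈ O_n` by the defining property (hD) of `O_n`. [folklore] -/
theorem transplant_contra (hM : 0 ≤ M) {Ω : Set E4} (hΩext : Ω ⊆ (Kerr.exterior M a : Set E4))
    (hTL : ∀ (M a : ℝ) (K₁ : Set E4) (δ₀ : ℝ), 0 ≤ M → IsCompact K₁ → 0 < δ₀ →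
      cthickening δ₀ K₁ ⊆ (Kerr.exterior M a : Set E4) →
      ∀ (c c' : ℝ → E4) (L : ℝ), 0 < L → (∀ r ∈ Icc 0 L, HasDerivAt c (c' r) r) → ContinuousOn c' (Icc 0 L) →
      (∀ r ∈ Icc 0 L, c r ∈ K₁ ∧ Kerr.bilin M a (c r) (c' r) (c' r) < 0 ∧ 0 < c' r 0) →
      ∃ δ > 0, δ ≤ δ₀ ∧ ∀ (z₁ z₂ : E4), ‖z₁‖ < δ → ‖z₂‖ < δ → ∀ B : E4 → E4 →L[ℝ] E4 →L[ℝ] ℝ,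
        (∀ y ∈ cthickening δ₀ K₁, ‖B y - Kerr.bilin M a y‖ < δ) →
        ∀ r ∈ Icc 0 L, c r + (1 - r / L) • z₁ + (r / L) • z₂ ∈ thickening δ₀ K₁ ∧
          HasDerivAt (fun r ↦ c r + (1 - r / L) • z₁ + (r / L) • z₂) (c' r + (1 / L) • (z₂ - z₁)) r ∧
          B (c r + (1 - r / L) • z₁ + (r / L) • z₂) (c' r + (1 / L) • (z₂ - z₁)) (c' r + (1 / L) • (z₂ - z₁)) < 0 ∧
          0 < (c' r + (1 / L) • (z₂ - z₁)) 0)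
    {l : Filter ℕ} [l.NeBot] {ε : ℕ → ℝ} (hεl : Tendsto ε l (𝓝 0))
    {B : ℕ → E4 → E4 →L[ℝ] E4 →L[ℝ] ℝ} (hB : ∀ n, ∀ y ∈ Ω, ‖B n y - Kerr.bilin M a y‖ ≤ ε n)
    {C O : ℕ → Set E4}
    (hD : ∀ n, ∀ y ∈ C n, ∀ z ∈ Ω, (∃ (c : ℝ → E4) (s₁ s₂ : ℝ), s₁ < s₂ ∧ c s₁ = y ∧ c s₂ = z ∧
      ∀ t ∈ Icc s₁ s₂, c t ∈ Ω ∧ ∃ v : E4, HasDerivAt c v t ∧ B n (c t) v v < 0 ∧ 0 < v 0) → z ∈ O n)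
    (β β' : ℝ → E4) (hβ'c : ContinuousOn β' (Icc 0 1))
    (hβ : ∀ r ∈ Icc 0 1, HasDerivAt β (β' r) r ∧ Kerr.bilin M a (β r) (β' r) (β' r) < 0 ∧ 0 < β' r 0)
    {δ₀ : ℝ} (hδ₀ : 0 < δ₀) (hthick : cthickening δ₀ (β '' Icc 0 1) ⊆ Ω)
    (b w : ℕ → E4) (hb : Tendsto b l (𝓝 (β 0))) (hw : Tendsto w l (𝓝 (β 1)))
    (hbC : ∀ᶠ n in l, b n ∈ C n) (hwO : ∀ᶠ n in l, w n ∉ O n) : False := by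
  have hβc : ContinuousOn β (Icc 0 1) := fun r hr ↦ (hβ r hr).1.continuousAt.continuousWithinAt
  have hK : IsCompact (β '' Icc 0 1) := isCompact_Icc.image_of_continuousOn hβc
  obtain ⟨δ, hδ, -, hmain⟩ := hTL M a (β '' Icc 0 1) δ₀ hM hK hδ₀ (hthick.trans hΩext) β β' 1 one_pos
    (fun r hr ↦ (hβ r hr).1) hβ'c (fun r hr ↦ ⟨mem_image_of_mem β hr, (hβ r hr).2.1, (hβ r hr).2.2⟩)
  have h1 : ∀ᶠ n in l, ‖b n - β 0‖ < δ := by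
    have := (tendsto_iff_norm_sub_tendsto_zero.1 hb).eventually (gt_mem_nhds hδ)
    exact this
  have h2 : ∀ᶠ n in l, ‖w n - β 1‖ < δ := (tendsto_iff_norm_sub_tendsto_zero.1 hw).eventually (gt_mem_nhds hδ)
  have h3 : ∀ᶠ n in l, ε n < δ := hεl.eventually (gt_mem_nhds hδ)
  obtain ⟨n, hn1, hn2, hn3, hnC, hnO⟩ := (h1.and (h2.and (h3.and (hbC.and hwO)))).exists
  have hBn : ∀ y ∈ cthickening δ₀ (β '' Icc 0 1), ‖B n y - Kerr.bilin M a y‖ < δ := fun y hy ↦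
    (hB n y (hthick hy)).trans_lt hn3
  have hcurve := hmain (b n - β 0) (w n - β 1) hn1 hn2 (B n) hBn
  refine hnO (hD n (b n) hnC (w n) ?_ ⟨fun r ↦ β r + (1 - r / 1) • (b n - β 0) + (r / 1) • (w n - β 1), 0, 1,
    zero_lt_one, ?_, ?_, fun r hr ↦ ?_⟩)
  · have h := (hcurve 1 (right_mem_Icc.2 zero_le_one)).1
    have : β 1 + (1 - (1 : ℝ) / 1) • (b n - β 0) + ((1 : ℝ) / 1) • (w n - β 1) = w n := by
      simp only [div_self one_ne_zero, sub_self, zero_smul, add_zero, one_smul]; abel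
    rw [this] at h
    exact hthick (thickening_subset_cthickening δ₀ _ h)
  · simp only [zero_div, sub_zero, one_smul, zero_smul, add_zero]; abel
  · simp only [div_self one_ne_zero, sub_self, zero_smul, add_zero, one_smul]; abel
  · obtain ⟨hth, hd, hBt, ht0⟩ := hcurve r hr
    exact ⟨hthick (thickening_subset_cthickening δ₀ _ hth), _, hd, hBt, ht0⟩

open Classical in
/-- **Limits of `B_n`-causal coordinate curves give causal relations of the Kerr exterior.** If `c_k` are
`t*`-parametrised `B_k`-causal coordinate curves on `[α_k, β_k]` inside the `H ≤ 2/5` region with `‖B_k − g‖ ≤ ε_k ≤ 1/80`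
along them, then the drifted curves `c_k + 50 ε_k (t − α_k) ∂_{t*}` are `g`-causal (DL3, stationarity), their lifts are
future causal curves of the exterior inside the closedness neighbourhood `W`, and so the limits of the endpoints are
causally related (`exists_nhds_causalRelation_closed`). [folklore] -/
theorem limit_mem_causalFuture [Kerr.Facts] (hM : 0 ≤ M)
    (hDL3 : ∀ (M a : ℝ) (x v : E4) (B : E4 →L[ℝ] E4 →L[ℝ] ℝ) (ε κ : ℝ), 0 ≤ M → Kerr.scalarH M a x ≤ 2 / 5 →
      ‖B - Kerr.bilin M a x‖ ≤ ε → ε ≤ 1 / 80 → B v v ≤ 0 → v 0 = 1 → 0 ≤ κ →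
      Kerr.bilin M a x (v + κ • E4.basisVector 0) (v + κ • E4.basisVector 0) ≤ 4 * ε - κ / 10)
    (c₀ : E4) (W : Set (Kerr.exterior M a))
    (hcl : ∀ (l : Filter ℕ) [l.NeBot] (x z : ℕ → Kerr.exterior M a) (x₀ z₀ : Kerr.exterior M a),
      x₀ ∈ W → z₀ ∈ W → Tendsto x l (𝓝 x₀) → Tendsto z l (𝓝 z₀) →
      (∀ᶠ k in l, ∃ (γ : ℝ → Kerr.exterior M a) (a' b' : ℝ), a' ≤ b' ∧
        (Kerr.smoothMetric M a (Kerr.rPlus M a)).IsFutureCausalCurveOn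
          (Kerr.exteriorSpacetime M a hM).timeOrientation γ (Icc a' b') ∧
        MapsTo γ (Icc a' b') W ∧ γ a' = x k ∧ γ b' = z k) →
      z₀ ∈ (Kerr.smoothMetric M a (Kerr.rPlus M a)).causalFuture (Kerr.exteriorSpacetime M a hM).timeOrientation {x₀})
    (ρ : ℝ) (hρW : ∀ y : Kerr.exterior M a, ‖(y : E4) - c₀‖ < ρ → y ∈ W)
    (hρext : ∀ y : E4, ‖y - c₀‖ < ρ → y ∈ Kerr.exterior M a)
    {l : Filter ℕ} [l.NeBot] (ε : ℕ → ℝ) (hε0 : ∀ n, 0 ≤ ε n) (hε4 : ∀ n, ε n ≤ 1 / 80)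
    (B : ℕ → E4 → E4 →L[ℝ] E4 →L[ℝ] ℝ) (c : ℕ → ℝ → E4) (α β : ℕ → ℝ) (hαβ : ∀ᶠ k in l, α k ≤ β k)
    (hc : ∀ᶠ k in l, ∀ s ∈ Icc (α k) (β k), Kerr.scalarH M a (c k s) ≤ 2 / 5 ∧
      ‖B k (c k s) - Kerr.bilin M a (c k s)‖ ≤ ε k ∧
      ‖c k s + (50 * ε k * (s - α k)) • E4.basisVector 0 - c₀‖ < ρ ∧
      ∃ v : E4, HasDerivAt (c k) v s ∧ B k (c k s) v v ≤ 0 ∧ v 0 = 1)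
    (x₀ z₀ : Kerr.exterior M a) (hx₀ : ‖(x₀ : E4) - c₀‖ < ρ) (hz₀ : ‖(z₀ : E4) - c₀‖ < ρ)
    (hx : Tendsto (fun k ↦ c k (α k)) l (𝓝 (x₀ : E4)))
    (hz : Tendsto (fun k ↦ c k (β k) + (50 * ε k * (β k - α k)) • E4.basisVector 0) l (𝓝 (z₀ : E4))) :
    z₀ ∈ (Kerr.smoothMetric M a (Kerr.rPlus M a)).causalFuture (Kerr.exteriorSpacetime M a hM).timeOrientation {x₀} := by
  -- the drifted curves and their lifts
  set d : ℕ → ℝ → E4 := fun k s ↦ c k s + (50 * ε k * (s - α k)) • E4.basisVector 0 with hd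
  set Λ : ℕ → ℝ → Kerr.exterior M a :=
    fun k s ↦ if h : d k s ∈ Kerr.exterior M a then (⟨d k s, h⟩ : Kerr.exterior M a) else x₀ with hΛ
  have hdα : ∀ k, d k (α k) = c k (α k) := fun k ↦ by simp [hd]
  refine hcl l (fun k ↦ Λ k (α k)) (fun k ↦ Λ k (β k)) x₀ z₀ (hρW x₀ hx₀) (hρW z₀ hz₀) ?_ ?_ ?_
  · -- `Λ k (α k) → x₀`
    rw [tendsto_subtype_rng]
    have hev : ∀ᶠ k in l, c k (α k) = ((Λ k (α k) : Kerr.exterior M a) : E4) := by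
      filter_upwards [hc, hαβ] with k hk hkαβ
      obtain ⟨-, -, hρk, -⟩ := hk (α k) (left_mem_Icc.2 hkαβ)
      have hmem : d k (α k) ∈ Kerr.exterior M a := hρext _ hρk
      simp only [hΛ, dif_pos hmem, hdα]
    exact hx.congr' hev
  · rw [tendsto_subtype_rng]
    have hev : ∀ᶠ k in l, d k (β k) = ((Λ k (β k) : Kerr.exterior M a) : E4) := by
      filter_upwards [hc, hαβ] with k hk hkαβ
      obtain ⟨-, -, hρk, -⟩ := hk (β k) (right_mem_Icc.2 hkαβ)
      have hmem : d k (β k) ∈ Kerr.exterior M a := hρext _ hρk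
      simp only [hΛ, dif_pos hmem]
    exact hz.congr' hev
  · filter_upwards [hc, hαβ] with k hk hkαβ
    have hk' : ∀ s ∈ Icc (α k) (β k), d k s ∈ Kerr.exterior M a ∧ ‖d k s - c₀‖ < ρ ∧
        ∃ v : E4, HasDerivAt (d k) (v + (50 * ε k) • E4.basisVector 0) s ∧
          Kerr.bilin M a (d k s) (v + (50 * ε k) • E4.basisVector 0) (v + (50 * ε k) • E4.basisVector 0) ≤ 0 ∧
          0 < (v + (50 * ε k) • E4.basisVector 0) 0 := by
      intro s hs
      obtain ⟨hH, hBk, hρk, v, hv, hBv, hv0⟩ := hk s hs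
      refine ⟨hρext _ hρk, hρk, v, ?_, ?_, ?_⟩
      · have h1 : HasDerivAt (fun s ↦ (50 * ε k * (s - α k)) • E4.basisVector 0) ((50 * ε k) • E4.basisVector 0) s := by
          have := ((hasDerivAt_id s).sub_const (α k)).const_mul (50 * ε k)
          simpa using this.smul_const (E4.basisVector 0)
        exact hv.add h1
      · have h := hDL3 M a (c k s) v (B k (c k s)) (ε k) (50 * ε k) hM hH hBk (hε4 k) hBv hv0
          (mul_nonneg (by norm_num) (hε0 k))
        rw [hd]
        simp only [Kerr.bilin_add_smul_basisVector_zero]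
        linarith [hε0 k]
      · have : (v + (50 * ε k) • E4.basisVector 0) 0 = 1 + 50 * ε k := by simp [hv0]
        rw [this]; linarith [hε0 k]
    choose! V hV using fun s (hs : s ∈ Icc (α k) (β k)) ↦ (hk' s hs).2.2
    obtain ⟨hcurve, -⟩ := isFutureCausalCurveOn_diteLift (a := a) hM x₀ (s := Icc (α k) (β k))
      (c := d k) (v := fun s ↦ V s + (50 * ε k) • E4.basisVector 0)
      (fun s hs ↦ (hk' s hs).1) (fun s hs ↦ (hV s hs).1) (fun s hs ↦ (hV s hs).2.1) (fun s hs ↦ (hV s hs).2.2)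
    refine ⟨Λ k, α k, β k, hkαβ, hcurve, fun s hs ↦ ?_, rfl, rfl⟩
    have hmem := (hk' s hs).1
    apply hρW
    simp only [hΛ, dif_pos hmem]
    exact (hk' s hs).2.1

end NoC0

/-- **Registered sub-goal `stub_noC0_orbitKinematics`** (NoC0KerrChart programme, crux `CaptureSufficesTame`, line
`only-the-third-law-is-generic`): the kinematics of the photon orbit (`NoC0.orbit_norm_sub_le`), verbatim. [cite: Sbierski2015, §7A] -/
theorem stub_noC0_orbitKinematics :
    ∀ (M a r₀ e : ℝ), (0 < M) → (0 ≤ a) → (3 * M ≤ r₀) → (r₀ * (r₀ - 3 * M) ^ 2 = 4 * a ^ 2 * M) → (e = 1 - a * √(M / r₀ ^ 3)) → (0 < e) → ∀ (s₁ s₂ : ℝ), (s₁ ≤ s₂) → ‖Kerr.orbitCurve a r₀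
      √(M / r₀ ^ 3) s₂ - Kerr.orbitCurve a r₀ √(M / r₀ ^ 3) s₁‖ ≤ 2 * (e * s₂ - e * s₁) :=
  NoC0.orbit_norm_sub_le

end Summit.FinalStateConjecture.FinalStateConjecture.Theorems.PhaseMixingCaptureCaptureSufficesTame

end
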